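import Literature.AlgebraicGeometry.Resolution.AlterationsNormalizationReduction
import Mathlib.AlgebraicGeometry.Morphisms.SchemeTheoreticallyDominant
import Mathlib.AlgebraicGeometry.Morphisms.Finite
import Mathlib.RingTheory.Algebraic.Integral
import HarnessLib

/-!
# Sections of the normalisation of a scheme finite and monogenic over a base, over an affine
# open of the base

Topic: `Literature/AlgebraicGeometry/Resolution`. Scheme-level bookkeeping for the endgame of
the crux `PicoverLocalModel` (normalised purely inseparable `p`-cyclic covers; J. Giraud,
Bull. SMF 111 (1983); K. Kato, Amer. J. Math. 116 (1994)). Let `q : Y → W` be a finite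
surjective morphism of integral schemes, `ν : Y^ν → Y` the normalisation (`normalization`,
`normalizationι` of `NormalizationOfVarieties.lean`), `g = ν ≫ q`, and `U ⊆ W` an affine open
over which `Γ(Y, q⁻¹U)` is generated over `Γ(W, U)` by one section `t_Y` with `t_Y^p = q^* c₀`
(the pulled-back `p`-cyclic cover, `PCyclicCoverSections.lean`). Then
(`sections_normalization_of_generated`) the `Γ(W, U)`-algebra `B = Γ(Y^ν, g⁻¹U)` is integrally
closed, integral over `Γ(W, U)` with injective structure map, and BIRATIONAL over
`Γ(W,U)[t]`, `t = ν^* t_Y`: every `z ∈ B` satisfies `d z = P(t)` with `d ∈ Γ(W, U) ∖ 0` — by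
Mathlib's `Scheme.Hom.normalizationObjIso`, `B` is the integral closure of `Γ(Y, q⁻¹U)` in the
function field `K(Y)`, a fraction field of `Γ(Y, q⁻¹U)`. Also the bookkeeping relating primes
of coordinate rings, points, and stalk maps (`mem_primeIdealOf_iff_of_stalkMap`,
`exists_point_of_prime`).

Sources: folklore (Q. Liu, *Algebraic Geometry and Arithmetic Curves*, Def. 4.1.24,
Prop. 4.1.22; Stacks 035H). [Giraud1983] context.
-/

noncomputable section

open CategoryTheory CategoryTheory.Limits AlgebraicGeometry TopologicalSpace Polynomial

namespace Literature.AlgebraicGeometry.Resolution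

universe u

/-! ## Primes, points and stalks on affine opens -/

/-- **Points over points, primes over primes.** For `g : X → Y`, affine opens `V ⊆ g⁻¹U`,
and `x ∈ V`: a section `s ∈ Γ(Y, U)` lies in the prime of `g x` iff `g^* s` lies in the prime
of `x` (the stalk map is a local homomorphism). [folklore] -/
theorem mem_primeIdealOf_iff_of_stalkMap {X Y : Scheme.{u}} (g : X ⟶ Y) {U : Y.Opens}
    (hU : IsAffineOpen U) {V : X.Opens} (hV : IsAffineOpen V) (hVU : V ≤ g ⁻¹ᵁ U) (x : X)
    (hx : x ∈ V) (s : Γ(Y, U)) :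
    g.appLE U V hVU s ∈ (hV.primeIdealOf ⟨x, hx⟩).asIdeal ↔
      s ∈ (hU.primeIdealOf ⟨g x, hVU hx⟩).asIdeal := by
  have h1 : X.presheaf.germ V x hx (g.appLE U V hVU s) =
      g.stalkMap x (Y.presheaf.germ U (g x) (hVU hx) s) := by
    rw [Scheme.Hom.germ_stalkMap_apply, Scheme.Hom.appLE, CommRingCat.comp_apply]
    exact TopCat.Presheaf.germ_res_apply X.presheaf (homOfLE hVU) x hx _
  letI := X.presheaf.algebra_section_stalk (⟨x, hx⟩ : V)
  letI := Y.presheaf.algebra_section_stalk (⟨g x, hVU hx⟩ : U)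
  haveI := hV.isLocalization_stalk ⟨x, hx⟩
  haveI := hU.isLocalization_stalk ⟨g x, hVU hx⟩
  have h2 := IsLocalization.AtPrime.to_map_mem_maximal_iff (X.presheaf.stalk x)
    (hV.primeIdealOf ⟨x, hx⟩).asIdeal (g.appLE U V hVU s)
  have h3 := IsLocalization.AtPrime.to_map_mem_maximal_iff (Y.presheaf.stalk (g x))
    (hU.primeIdealOf ⟨g x, hVU hx⟩).asIdeal s
  rw [← h2, ← h3, IsLocalRing.mem_maximalIdeal, IsLocalRing.mem_maximalIdeal, mem_nonunits_iff,
    mem_nonunits_iff]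
  change ¬ IsUnit (X.presheaf.germ V x hx (g.appLE U V hVU s)) ↔
    ¬ IsUnit (Y.presheaf.germ U (g x) (hVU hx) s)
  rw [h1]
  exact (isUnit_map_iff (g.stalkMap x).hom _).not

/-- Every prime of the coordinate ring of an affine open is the prime of a point. [folklore] -/
theorem exists_point_of_prime {X : Scheme.{u}} {V : X.Opens} (hV : IsAffineOpen V)
    (𝔓 : Ideal Γ(X, V)) [𝔓.IsPrime] : ∃ x : V, hV.primeIdealOf x = ⟨𝔓, inferInstance⟩ :=
  ⟨⟨hV.fromSpec ⟨𝔓, inferInstance⟩, hV.range_fromSpec.le ⟨_, rfl⟩⟩, by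
    apply hV.fromSpec.isOpenEmbedding.injective
    rw [hV.fromSpec_primeIdealOf]⟩

/-! ## The normalisation over an affine open of the base -/

/-- **Sections of the normalisation over an affine open of the base**, for a finite surjective
`q : Y → W` of integral schemes with `Γ(Y, q⁻¹U)` generated over `Γ(W, U)` by a section `t_Y`
with `t_Y^p = q^* c₀`. See the module docstring. [folklore] -/
theorem sections_normalization_of_generated {Y W : Scheme.{u}} [IsIntegral Y] [IsIntegral W]
    (q : Y ⟶ W) [IsFinite q] [Surjective q] (U : W.affineOpens) {p : ℕ} (hp : p ≠ 0)
    (c₀ : Γ(W, U)) (tY : Γ(Y, q ⁻¹ᵁ (U : W.Opens))) (htYp : tY ^ p = q.app U c₀)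
    (hgen : ∀ b : Γ(Y, q ⁻¹ᵁ (U : W.Opens)), ∃ P : Γ(W, U)[X], b = P.eval₂ (q.app U).hom tY)
    (hne : Nonempty ((normalizationι Y ≫ q) ⁻¹ᵁ (U : W.Opens))) :
    IsAffineOpen ((normalizationι Y ≫ q) ⁻¹ᵁ (U : W.Opens)) ∧
    IsIntegrallyClosed Γ(normalization Y, (normalizationι Y ≫ q) ⁻¹ᵁ (U : W.Opens)) ∧
    ((normalizationι Y ≫ q).app U).hom.IsIntegral ∧
    Function.Injective ((normalizationι Y ≫ q).app U) ∧
    ∃ t : Γ(normalization Y, (normalizationι Y ≫ q) ⁻¹ᵁ (U : W.Opens)),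
      t ^ p = ((normalizationι Y ≫ q).app U) c₀ ∧
      ∀ z, ∃ d : Γ(W, U), d ≠ 0 ∧ ∃ P : Γ(W, U)[X],
        ((normalizationι Y ≫ q).app U) d * z = P.eval₂ ((normalizationι Y ≫ q).app U).hom t := by
  have hVYaff : IsAffineOpen (q ⁻¹ᵁ (U : W.Opens)) := U.2.preimage q
  have haff : IsAffineOpen ((normalizationι Y ≫ q) ⁻¹ᵁ (U : W.Opens)) := U.2.preimage _
  haveI : Nonempty ((normalizationι Y ≫ q) ⁻¹ᵁ (U : W.Opens)) := hne
  haveI : Nonempty (q ⁻¹ᵁ (U : W.Opens)) := by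
    obtain ⟨⟨y, hy⟩⟩ := hne
    exact ⟨⟨normalizationι Y y, hy⟩⟩
  -- integrality and injectivity of `g^*`
  have hint : ((normalizationι Y ≫ q).app U).hom.IsIntegral := (normalizationι Y ≫ q).isIntegral_app U U.2
  haveI : IsSchemeTheoreticallyDominant (normalizationι Y ≫ q) := .of_isDominant _
  have hinj : Function.Injective ((normalizationι Y ≫ q).app U) := (normalizationι Y ≫ q).app_injective U
  -- `B ≅ integralClosure Γ(Y, q⁻¹U) K(Y)`
  letI algξ := ((fromSpecFunctionField Y).app (q ⁻¹ᵁ (U : W.Opens))).hom.toAlgebra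
  haveI : IsFractionRing Γ(Y, q ⁻¹ᵁ (U : W.Opens)) Y.functionField :=
    functionField_isFractionRing_of_isAffineOpen Y _ hVYaff
  let ef := functionFieldAlgEquivSections (X := Y) (q ⁻¹ᵁ (U : W.Opens))
  let e₁ : integralClosure Γ(Y, q ⁻¹ᵁ (U : W.Opens)) Y.functionField ≃ₐ[Γ(Y, q ⁻¹ᵁ (U : W.Opens))]
      integralClosure Γ(Y, q ⁻¹ᵁ (U : W.Opens))
        Γ(Spec Y.functionField, fromSpecFunctionField Y ⁻¹ᵁ (q ⁻¹ᵁ (U : W.Opens))) :=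
    ((integralClosure _ Y.functionField).equivMapOfInjective ef.toAlgHom ef.injective).trans
      (Subalgebra.equivOfEq _ _ (integralClosure_map_algEquiv ef))
  let e₂ : Γ(normalization Y, (normalizationι Y ≫ q) ⁻¹ᵁ (U : W.Opens)) ≃+*
      integralClosure Γ(Y, q ⁻¹ᵁ (U : W.Opens))
        Γ(Spec Y.functionField, fromSpecFunctionField Y ⁻¹ᵁ (q ⁻¹ᵁ (U : W.Opens))) :=
    ((fromSpecFunctionField Y).normalizationObjIso hVYaff).commRingCatIsoToRingEquiv
  let E : integralClosure Γ(Y, q ⁻¹ᵁ (U : W.Opens)) Y.functionField ≃+*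
      Γ(normalization Y, (normalizationι Y ≫ q) ⁻¹ᵁ (U : W.Opens)) := e₁.toRingEquiv.trans e₂.symm
  have hEalg : ∀ x : Γ(Y, q ⁻¹ᵁ (U : W.Opens)),
      E (algebraMap _ _ x) = (normalizationι Y).app (q ⁻¹ᵁ (U : W.Opens)) x := by
    intro x
    change e₂.symm (e₁ (algebraMap _ _ x)) = _
    rw [AlgEquiv.commutes]
    have h := (fromSpecFunctionField Y).fromNormalization_app hVYaff
    change _ = (fromSpecFunctionField Y).fromNormalization.app _ x
    rw [h]
    rfl
  -- (G1) integrally closed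
  haveI : IsIntegrallyClosed (integralClosure Γ(Y, q ⁻¹ᵁ (U : W.Opens)) Y.functionField) :=
    integralClosure.isIntegrallyClosedOfFiniteExtension (K := Y.functionField) (L := Y.functionField)
  have hic : IsIntegrallyClosed Γ(normalization Y, (normalizationι Y ≫ q) ⁻¹ᵁ (U : W.Opens)) :=
    IsIntegrallyClosed.of_equiv E
  refine ⟨haff, hic, hint, hinj, (normalizationι Y).app (q ⁻¹ᵁ (U : W.Opens)) tY, ?_, fun z => ?_⟩
  · have h := congrArg ((normalizationι Y).app (q ⁻¹ᵁ (U : W.Opens))).hom htYp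
    rw [map_pow] at h
    exact h
  -- birationality
  haveI : Nonempty (U : W.Opens) := by
    obtain ⟨⟨y, hy⟩⟩ := hne
    exact ⟨⟨(normalizationι Y ≫ q) y, hy⟩⟩
  obtain ⟨n, d', hd', hnd⟩ := IsFractionRing.div_surjective (A := Γ(Y, q ⁻¹ᵁ (U : W.Opens)))
    ((E.symm z : integralClosure Γ(Y, q ⁻¹ᵁ (U : W.Opens)) Y.functionField) : Y.functionField)
  -- `d'` is algebraic over `Γ(W, U)`
  letI algq : Algebra Γ(W, U) Γ(Y, q ⁻¹ᵁ (U : W.Opens)) := (q.app U).hom.toAlgebra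
  have htYint : IsIntegral Γ(W, U) tY := by
    refine ⟨X ^ p - C c₀, monic_X_pow_sub_C _ hp, ?_⟩
    rw [eval₂_sub, eval₂_X_pow, eval₂_C, htYp, RingHom.algebraMap_toAlgebra, sub_self]
  have hd'int : IsIntegral Γ(W, U) d' := by
    obtain ⟨qd, hqd⟩ := hgen d'
    rw [hqd, ← RingHom.algebraMap_toAlgebra (q.app U).hom, ← aeval_def]
    refine Algebra.adjoin_le (S := integralClosure Γ(W, U) Γ(Y, q ⁻¹ᵁ (U : W.Opens))) ?_
      (aeval_mem_adjoin_singleton _ tY)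
    exact Set.singleton_subset_iff.mpr htYint
  have hd'0 : d' ≠ 0 := nonZeroDivisors.ne_zero hd'
  obtain ⟨r, hr, c, hc⟩ := hd'int.isAlgebraic.exists_nonzero_dvd hd'
  rw [RingHom.algebraMap_toAlgebra] at hc
  -- `q^* r = d' c`, so `g^* r · z = ν^*(c n)`
  have hK : algebraMap _ Y.functionField (q.app U r) *
      ((E.symm z : integralClosure Γ(Y, q ⁻¹ᵁ (U : W.Opens)) Y.functionField) : Y.functionField) =
      algebraMap _ Y.functionField (c * n) := by
    have hdK : algebraMap _ Y.functionField d' ≠ 0 :=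
      (map_ne_zero_iff _ (IsFractionRing.injective _ Y.functionField)).mpr hd'0
    rw [← hnd, hc, map_mul, map_mul]
    field_simp
  have hIC : algebraMap _ (integralClosure Γ(Y, q ⁻¹ᵁ (U : W.Opens)) Y.functionField) (q.app U r) *
      E.symm z = algebraMap _ _ (c * n) := Subtype.ext hK
  have hB := congrArg E hIC
  rw [map_mul, hEalg, hEalg, RingEquiv.apply_symm_apply] at hB
  obtain ⟨P, hP⟩ := hgen (c * n)
  refine ⟨r, hr, P, ?_⟩
  have hgoal : ((normalizationι Y ≫ q).app U) r * z =
      (normalizationι Y).app (q ⁻¹ᵁ (U : W.Opens)) (c * n) := hB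
  rw [hgoal, hP, Polynomial.hom_eval₂]
  rfl

end Literature.AlgebraicGeometry.Resolution

end
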